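import Mathlib
import Summits.NavierStokesRegularity.NavierStokesRegularity.Theses.EfficiencyFloor
import HarnessLib

/-!
# `EfficiencyFloor.Assembly` — the route's assembly (item stmt-NavierStokesRegularity-22869; pure logic)

**Statement.** `ProductionEfficiencyDecay → FloorOfEfficiencyDecay → BlowupEnstrophyUnbounded →
EnstrophyQuarterLaw → NavierStokesRegularity`.

PROOF. The route file `Theses/EfficiencyFloor.lean` carries the planner-authored, kernel-checked
deciding theorem `Theses.EfficiencyFloor.closes`, whose hypotheses are exactly the route's two cruxes
and two supports and whose conclusion is the sub-problem Statement; the assembly item is that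
implication written as ONE proposition (the curried form of `closes`), so it is closed by applying
`closes` to the hypotheses. This proves an IMPLICATION only: the hypotheses (two of them open
cruxes) remain hypotheses.

HONEST FRAMING: pure logic between the route's own statements; the file does NOT prove
`NavierStokesRegularity` — it proves that the route's items would imply it.
-/

noncomputable section

set_option linter.dupNamespace false

namespace Summit.NavierStokesRegularity.NavierStokesRegularity.Theorems

open Summit.NavierStokesRegularity.NavierStokesRegularity.Theses.EfficiencyFloor in
/-- **Item stmt-NavierStokesRegularity-22869** (`EfficiencyFloor.Assembly`): the route's two cruxes
and two supports imply the sub-problem Statement, by the route file's deciding theorem `closes`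
(an implication; its hypotheses stay hypotheses). [this file] -/
theorem efficiencyFloor_assembly_proof :
    Summit.NavierStokesRegularity.NavierStokesRegularity.Theses.EfficiencyFloor.Assembly := by
  unfold Summit.NavierStokesRegularity.NavierStokesRegularity.Theses.EfficiencyFloor.Assembly
  intro h₁ h₂ h₃ h₄
  exact closes h₁ h₂ h₃ h₄

end Summit.NavierStokesRegularity.NavierStokesRegularity.Theorems

end
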